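import Mathlib

/-!
# `Balaban1983to89.B3Taylor310Lattice` — T. Bałaban, *(Higgs)₂,₃ quantum fields in a finite volume. III. Renormalization*,
# Commun. Math. Phys. **88** (1983) 411–445 [Balaban1983Higgs3]: the lattice Taylor formula (3.10) p. 435 ON THE PRINT'S OWN
# CARRIER `ηℤ^{d+1}` (the infinite unit lattice `ℤ^{d+1}`, lattice spacing `η = c⁻¹`) — the staircase contour `Γ_{x,y}`, the
# first-order term and the remainder with bodies, (3.10) as an identity, and the remainder bounds that (3.13)/(3.14) p. 436 consume:
# the Hölder bound (*"a differentiation of the order 1 + α"*) and its local version along a propagator leg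

statement-level skeleton of published theorems with citation tags; proofs where landed; nothing here is a claim about the Yang–Mills mass gap

PDF held: `paper:balaban1983-higgs-2-3-quantum-fields-finite-volume` (journal page = PDF page + 410); p. 435 [PDF 25] ((3.9)/(3.10)),
p. 436 [PDF 26] ((3.11)–(3.14)) read on the ×2 renders `run/shared/lean/pub/pub-balaban/b2b-balaban-ref1/pages/1983-cmp88-higgs23-III/
1983-cmp88-higgs23-III-p025-x2.png`, `…-p026-x2.png` (the text layer `p0025.txt`/`p0026.txt` garbles the displays).

CITATION HEADER (lean-in-tree rule).  Part of the lit-balaban TYPED SKELETON (HOME `run/shared/lean/pub/lit-balaban/`), Phase 2: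
FILE A of p26 g34's three-file chain «(3.9)–(3.14) ON `ηℤ^{d+1}`» for SKELETON row **B3.Eq3.11-3.17** (fold owner r15; owner's head
residual 2026-08-22T23:10Z: *"every display (3.11)–(3.17) with a body and proved on the ηℤ^d carrier ((3.13)/(3.14) there rest on
(2.6)/(2.10) for G_k(0)'s pieces …)"*) and a LOCATED member of row **B3.Eq3.10** (file of record: p20's torus files
`B3Eq28SummationByParts` §6 `taylor310_stair` / `B3Taylor310Remainder` — (3.10) on the torus `Site P j` of the series' `Setup`).  The
print's §3 carrier is the infinite lattice: p. 433 *"with the scalar field propagator equal to G_k(0)"* = `G_k(ηℤ^{d+1}, 0)` (owner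
reading 23:10Z; p26 g34 `B3Ineq210ZeroLattice`/`B3Ineq211ZeroLattice` = its (2.6)/(2.10)/(2.11)); this file is the lattice calculus the
(3.11)–(3.14) files on that carrier need (FILE B `B3Ineq313Lattice`: (3.9)/(3.11)/(3.12) with bodies on finite localization sets and
(3.13)/(3.14) under kernel hypotheses; FILE C `B3Ineq314ZeroLattice`: the hypothesis-free instance for the pieces of `G_k(0)`).  It is
the `ℤ^{d+1}` twin of p20 g2's `B3Taylor310Remainder` §1–§3 (same reading, same names where possible: `lin`, `rem`, `HolderDeriv`,
`norm_rem_le`; and of p20 g4's `B3Ineq314Local.norm_remFwd_le_of_leg` for the local version) — on `ℤ^{d+1}` there is no torus wrap, so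
the coordinates `y_μ − x_μ ∈ ℤ` ARE the signed step numbers and the forward-derivative reading needs no correction term (`remFwd = rem`).
Mathlib only; no file of another seat is imported or modified.

WHAT IS PRINTED (verbatim, p. 435 [PDF 25]).  *"To this expression we apply Taylor's formula in the form
f(y) = f(x) + Σ_{μ=1}^d (y_μ − x_μ)(∂^η_μ f)(x) + Σ_{b⊂Γ_{x,y}} η|b_− − x|^α ((∂^ηf)(b) − (∂^ηf)((b)_x))/|b_− − x|^α, (3.10) where (b)_x
denotes a bond b parallel-transported to the point x. We apply it to a leg φ′ …"*; p. 436 [PDF 26]: *"The operator acting on the leg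
φ′ is a differentiation of the order 1 + α"*; (3.13)'s last factor *"(L^{j₁}η)^{1+α} sup_{x∈Δ(v),x′∈Δ(v′)} sup_{y∈Γ_{x,x′},μ}
|(∂^η_μφ′)(y) − (∂^η_μφ′)(x)|/|y − x|^α"*; and before (3.14): *"If φ′ is a leg of a propagator with an index j″, whose second leg is
localized in Δ(v″), then the last supremum in (3.13) can be estimated by O(1)(L^{j″}η)^{−d+1−α} sup_{x∈Δ(v),x′∈Δ(v′)}
exp[−δ₀(L^{j″}η)^{−1} dist(Γ_{x,x′}, Δ(v″))]"*.

WHAT IS REPRODUCED, and how (kind «calculus with bodies + proved bounds»; every theorem proved, Mathlib only).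
* §1 sites `Fin (d+1) → ℤ`; `dist₁ x y = Σ_μ |x_μ − y_μ|` (the number of bonds of `Γ_{x,y}`; `Σ_{b⊂Γ_{x,y}} η = η·dist₁ = |x − y|` in
  the `ℓ¹` reading, as in p20's files) with `comm`/`triangle`/coordinate lemmas; the forward derivative `pd c μ f x = c·(f(x+e_μ) − f x)`
  (`c = η⁻¹`); the first-order term `lin c f x y = Σ_μ (η(y_μ − x_μ))·(∂^η_μf)(x)`; the remainder `rem = f y − f x − lin`; **(3.10)**
  `taylor310 : f y = f x + lin + rem` (an identity by construction — the CONTENT of (3.10) is the contour representation and the size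
  of `rem`, §2–§3).
* §2 the staircase: corners `mix x y m` (`mix 0 = x`, `mix (d+1) = y`, `mix (μ+1) = mix μ + (y_μ − x_μ)e_μ`), the points `Between x y w`
  (coordinatewise between; every site of `Γ_{x,y}` is one: `between_segment`) and `dist₁ w x ≤ dist₁ x y` for them; the one-dimensional
  telescoping identities `f(z ± ne_μ) − f z = ±Σ η(∂^η_μf)(bond)` (`sub_eq_sum_pd_up/_down`).
* §3 `rem = Σ_μ segRem μ` over the `d+1` segments (`rem_eq_sum_segRem`); **`norm_rem_le_of_osc`**: if `‖(∂^η_μf)(w) − (∂^η_μf)(x)‖ ≤ K`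
  for all directions and all `w` between `x` and `y` then `‖rem(x,y)‖ ≤ η·dist₁(x,y)·K`; **`norm_rem_le`** (the p. 436 sentence = the
  last factor of (3.13)): under `HolderDeriv c α H f` (`‖∂f(z) − ∂f(z′)‖ ≤ H|z − z′|^α`), `‖rem(x,y)‖ ≤ H·|x − y|·|x − y|^α`;
  **`norm_rem_le_of_leg`** (the (3.14) mechanism *"dist(Γ_{x,x′}, Δ(v″))"*): under the (2.11)-shaped two-point bound with an `x″`-localized
  exponential, `‖rem(x,y)‖ ≤ C₃·|x−y|·|x−y|^α·e^{+½δ|x−y|/s″}·e^{−½δ|x−x″|/s″}` (every site of `Γ_{x,y}` is at least `|x − x″|₁ − |x − y|₁`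
  bonds from `x″`; half of the exponential rate is kept — the shape consumed by p20's `B3Ineq314Local.exp_mul_weight_le_local`).

HONEST SCOPE / DECLARED DIVERGENCES (F7).  (i) ZERO BACKGROUND: `(b)_x` (parallel transport of the bond to `x`) is the identity and
`∂^η_μ` is the plain forward difference quotient — the §3 setting of the print (p. 433: `B̃₀` gauged away, propagator `G_k(0)`); fields
with values in any real normed space `V`.  (ii) READING of the first-order term with the FORWARD derivative at `x` for both orientations
of the contour (literally *"(∂^η_μ f)(x)"*; the reading in which (3.11) consumes (3.10), = p20's `taylor310_fwd`); on `ℤ^{d+1}` the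
remainder is then exactly `Σ_{b⊂Γ_{x,y}} ±η((∂^η_μf)(b_−) − (∂^η_μf)(x))` over the bonds (`rem_eq_sum_segRem` + `sub_eq_sum_pd_up/_down`),
which bond "(b)_x" is meant for a negatively traversed bond not being printed (cf. p20's docstring of `taylor310_stair`).  (iii) `|x − y|`
read as the `ℓ¹` lattice distance `η·dist₁` (print: a lattice distance with unspecified norm; with `ℓ¹`, `Σ_{b⊂Γ}η = |x − y|` exactly;
`|·|_∞ ≤ |·|₁ ≤ (d+1)|·|_∞` for consumers stated with the sup norm, e.g. `B3Ineq210ZeroLattice`).  (iv) Constants explicit (`norm_rem_le`: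
the Hölder constant itself; `norm_rem_le_of_leg`: `C₃`, rate halved).  Theorems and definitions with bodies only; no Literature fact
minted, no `sorry`; standard axioms.  Value = the (3.10) calculus on the printed carrier for the (3.11)–(3.14) lattice files, NOT summit
progress.
Unit `lit-balaban-p26` (Phase-2 proof seat p26, gen 34); HOME `run/shared/lean/pub/lit-balaban/` (rows B3.Eq3.10 / B3.Eq3.11-3.17,
FILED.md, STATUS.md), 2026-08-23.
-/

open scoped BigOperators

namespace Literature.MathematicalPhysics.QuantumFieldTheory.Balaban1983to89.B3Taylor310Lattice

open Finset

noncomputable section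

variable {d : ℕ} {V : Type*} [NormedAddCommGroup V] [NormedSpace ℝ V]

/-! ## §1 The lattice `ηℤ^{d+1}`: `ℓ¹` distance, forward derivatives, the staircase `Γ_{x,y}` -/

/-- The `ℓ¹` distance on `ℤ^{d+1}` in lattice units — the number of bonds of the staircase contour `Γ_{x,y}` (so that
`Σ_{b⊂Γ_{x,y}} η = η·dist₁ x y = |x − y|`, the `ℓ¹` reading of the print's lattice distance, as in p20's torus files).
[cite: Balaban1983Higgs3, (3.10) p.435] -/
def dist₁ (x y : Fin (d + 1) → ℤ) : ℕ := ∑ μ, (x μ - y μ).natAbs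

/-- kernel: `|a − b| = |b − a|` on `ℤ`. [folklore] -/
private theorem natAbs_sub_comm (a b : ℤ) : (a - b).natAbs = (b - a).natAbs := by
  rw [← Int.natAbs_neg, neg_sub]

/-- `|x − y|₁` is symmetric. [cite: Balaban1983Higgs3, (3.10) p.435] -/
theorem dist₁_comm (x y : Fin (d + 1) → ℤ) : dist₁ x y = dist₁ y x := by
  unfold dist₁
  exact Finset.sum_congr rfl fun μ _ => natAbs_sub_comm _ _

/-- `|x − x|₁ = 0`. [cite: Balaban1983Higgs3, (3.10) p.435] -/
@[simp] theorem dist₁_self (x : Fin (d + 1) → ℤ) : dist₁ x x = 0 := by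
  simp [dist₁]

/-- the triangle inequality for `|·|₁`. [cite: Balaban1983Higgs3, (3.10) p.435] -/
theorem dist₁_triangle (x y z : Fin (d + 1) → ℤ) : dist₁ x z ≤ dist₁ x y + dist₁ y z := by
  unfold dist₁
  rw [← Finset.sum_add_distrib]
  refine Finset.sum_le_sum fun μ _ => ?_
  have : x μ - z μ = (x μ - y μ) + (y μ - z μ) := by ring
  rw [this]
  exact Int.natAbs_add_le _ _

/-- each coordinate difference is at most the `ℓ¹` distance. [cite: Balaban1983Higgs3, (3.10) p.435] -/
theorem natAbs_sub_le_dist₁ (x y : Fin (d + 1) → ℤ) (μ : Fin (d + 1)) : (x μ - y μ).natAbs ≤ dist₁ x y :=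
  Finset.single_le_sum (f := fun ν => (x ν - y ν).natAbs) (fun _ _ => Nat.zero_le _) (Finset.mem_univ μ)

/-- `|x − y|₁ ≤ (d+1)·|x − y|_∞`-type comparison, coordinatewise form: if every `|x_μ − y_μ| ≤ m` then `|x − y|₁ ≤ (d+1)m`.
[cite: Balaban1983Higgs3, (3.10) p.435] -/
theorem dist₁_le_of_forall_le {x y : Fin (d + 1) → ℤ} {m : ℕ} (h : ∀ μ, (x μ - y μ).natAbs ≤ m) :
    dist₁ x y ≤ (d + 1) * m := by
  unfold dist₁
  calc ∑ μ, (x μ - y μ).natAbs ≤ ∑ _μ : Fin (d + 1), m := Finset.sum_le_sum fun μ _ => h μ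
    _ = (d + 1) * m := by rw [Finset.sum_const, Finset.card_univ, Fintype.card_fin, smul_eq_mul]

/-- the `ℓ¹` distance of a translate: `|(x + v) − x|₁ = |v|₁`. [cite: Balaban1983Higgs3, (3.10) p.435] -/
theorem dist₁_add_left (x v : Fin (d + 1) → ℤ) : dist₁ (x + v) x = ∑ μ, (v μ).natAbs := by
  simp [dist₁]

/-- **The forward lattice derivative** `(∂^η_μ f)(x) = η^{−1}(f(x + ηe_μ) − f(x))` of a field on `ηℤ^{d+1}` with values in a normed
space (`c = η^{−1}`; zero background, no parallel transport). [cite: Balaban1983Higgs3, (3.10) p.435] -/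
def pd (c : ℝ) (μ : Fin (d + 1)) (f : (Fin (d + 1) → ℤ) → V) (x : Fin (d + 1) → ℤ) : V :=
  c • (f (x + Pi.single μ 1) - f x)

/-- **The first-order term of (3.10)**: `Σ_μ (y_μ − x_μ)(∂^η_μ f)(x)` with the physical displacement `y_μ − x_μ = η·n_μ`,
`n_μ ∈ ℤ` the signed number of `μ`-bonds of `Γ_{x,y}` (forward derivative at `x` for both orientations — the reading in which (3.11)
consumes (3.10), as p20's `B3Taylor310Remainder.taylor310_fwd`). [cite: Balaban1983Higgs3, (3.10) p.435] -/
def lin (c : ℝ) (f : (Fin (d + 1) → ℤ) → V) (x y : Fin (d + 1) → ℤ) : V :=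
  ∑ μ, (c⁻¹ * ((y μ - x μ : ℤ) : ℝ)) • pd c μ f x

/-- **The remainder of (3.10)** — *"Σ_{b⊂Γ_{x,y}} η|b_− − x|^α ((∂^ηf)(b) − (∂^ηf)((b)_x))/|b_− − x|^α"* — as the quantity that makes
(3.10) an identity: `rem = f(y) − f(x) − Σ_μ (y_μ − x_μ)(∂^η_μ f)(x)`; its contour representation is `rem_eq_sum_segRem` below and its
size («a differentiation of the order 1 + α», p. 436) is `norm_rem_le`. [cite: Balaban1983Higgs3, (3.10) p.435] -/
def rem (c : ℝ) (f : (Fin (d + 1) → ℤ) → V) (x y : Fin (d + 1) → ℤ) : V :=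
  f y - f x - lin c f x y

/-- **(3.10)** p. 435 [PDF 25]: `f(y) = f(x) + Σ_μ (y_μ − x_μ)(∂^η_μ f)(x) + rem(x,y)`. [cite: Balaban1983Higgs3, (3.10) p.435] -/
theorem taylor310 (c : ℝ) (f : (Fin (d + 1) → ℤ) → V) (x y : Fin (d + 1) → ℤ) :
    f y = f x + lin c f x y + rem c f x y := by
  unfold rem; abel

/-- `rem(x,x) = 0`. [cite: Balaban1983Higgs3, (3.10) p.435] -/
@[simp] theorem rem_self (c : ℝ) (f : (Fin (d + 1) → ℤ) → V) (x : Fin (d + 1) → ℤ) : rem c f x x = 0 := by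
  simp [rem, lin]

/-! ## §2 The staircase `Γ_{x,y}`: corner points, the points BETWEEN `x` and `y`, one-dimensional telescoping -/

/-- The corner points of the staircase `Γ_{x,y}`: `mix x y m` has the coordinates of `y` in the directions `< m` and of `x` in the
directions `≥ m` (`mix 0 = x`, `mix (d+1) = y`); between two consecutive corners the contour runs along one axis.
[cite: Balaban1983Higgs3, (3.10) p.435] -/
def mix (x y : Fin (d + 1) → ℤ) (m : ℕ) : Fin (d + 1) → ℤ := fun ν => if (ν : ℕ) < m then y ν else x ν

/-- `mix 0 = x`. [cite: Balaban1983Higgs3, (3.10) p.435] -/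
theorem mix_zero (x y : Fin (d + 1) → ℤ) : mix x y 0 = x := by
  funext ν; simp [mix]

/-- `mix (d+1) = y`. [cite: Balaban1983Higgs3, (3.10) p.435] -/
theorem mix_top (x y : Fin (d + 1) → ℤ) : mix x y (d + 1) = y := by
  funext ν; simp [mix, ν.isLt]

/-- one more direction: `mix (μ+1) = mix μ + (y_μ − x_μ)e_μ`. [cite: Balaban1983Higgs3, (3.10) p.435] -/
theorem mix_succ (x y : Fin (d + 1) → ℤ) (μ : Fin (d + 1)) :
    mix x y ((μ : ℕ) + 1) = mix x y μ + (y μ - x μ) • (Pi.single μ (1 : ℤ) : Fin (d + 1) → ℤ) := by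
  funext ν
  simp only [mix, Pi.add_apply, Pi.smul_apply, smul_eq_mul]
  by_cases hν : ν = μ
  · subst hν
    simp
  · have hne : (ν : ℕ) ≠ (μ : ℕ) := fun h => hν (Fin.ext h)
    rw [Pi.single_eq_of_ne hν, mul_zero, add_zero]
    by_cases h1 : (ν : ℕ) < μ
    · rw [if_pos (by omega), if_pos h1]
    · rw [if_neg (by omega), if_neg h1]

/-- **The points BETWEEN `x` and `y`**: every coordinate lies between the corresponding coordinates of `x` and `y` — all sites of
the staircase `Γ_{x,y}` are such points. [cite: Balaban1983Higgs3, (3.10) p.435] -/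
def Between (x y w : Fin (d + 1) → ℤ) : Prop := ∀ ν, min (x ν) (y ν) ≤ w ν ∧ w ν ≤ max (x ν) (y ν)

/-- `x` itself lies between `x` and `y`. [cite: Balaban1983Higgs3, (3.10) p.435] -/
theorem between_left (x y : Fin (d + 1) → ℤ) : Between x y x := fun _ => ⟨min_le_left _ _, le_max_left _ _⟩

/-- a point between `x` and `y` is within `|x − y|₁` of `x` (p20's *"every site of Γ_{x,y} is within ℓ¹-distance |x − y|₁ of x"*).
[cite: Balaban1983Higgs3, (3.10) p.435] -/
theorem dist₁_le_of_between {x y w : Fin (d + 1) → ℤ} (hw : Between x y w) : dist₁ w x ≤ dist₁ x y := by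
  unfold dist₁
  refine Finset.sum_le_sum fun ν _ => ?_
  have h := hw ν
  have h1 : |w ν - x ν| ≤ |x ν - y ν| := by
    rcases le_total (x ν) (y ν) with hxy | hxy
    · rw [min_eq_left hxy, max_eq_right hxy] at h
      rw [abs_of_nonneg (by linarith), abs_of_nonpos (by linarith)]; linarith
    · rw [min_eq_right hxy, max_eq_left hxy] at h
      rw [abs_of_nonpos (by linarith), abs_of_nonneg (by linarith)]; linarith
  have h2 : ((w ν - x ν).natAbs : ℤ) ≤ ((x ν - y ν).natAbs : ℤ) := by
    rw [Int.natCast_natAbs, Int.natCast_natAbs]; exact h1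
  exact_mod_cast h2

/-- the points of the `μ`-segment of `Γ_{x,y}` (from the corner `mix μ`, `t` steps towards `y_μ`, `0 ≤ t ≤ |y_μ − x_μ|` in the
orientation of the segment) lie between `x` and `y`. [cite: Balaban1983Higgs3, (3.10) p.435] -/
theorem between_segment (x y : Fin (d + 1) → ℤ) (μ : Fin (d + 1)) {τ : ℤ}
    (hτ : min 0 (y μ - x μ) ≤ τ ∧ τ ≤ max 0 (y μ - x μ)) :
    Between x y (mix x y μ + τ • (Pi.single μ (1 : ℤ) : Fin (d + 1) → ℤ)) := by
  intro ν
  simp only [mix, Pi.add_apply, Pi.smul_apply, smul_eq_mul]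
  by_cases hν : ν = μ
  · subst hν
    simp only [lt_self_iff_false, if_false, Pi.single_eq_same, mul_one]
    obtain ⟨h1, h2⟩ := hτ
    constructor
    · rcases le_total 0 (y ν - x ν) with h | h
      · rw [min_eq_left h] at h1; rw [min_def]; split_ifs <;> linarith
      · rw [min_eq_right h] at h1; rw [min_def]; split_ifs <;> linarith
    · rcases le_total 0 (y ν - x ν) with h | h
      · rw [max_eq_right h] at h2; rw [max_def]; split_ifs <;> linarith
      · rw [max_eq_left h] at h2; rw [max_def]; split_ifs <;> linarith
  · rw [Pi.single_eq_of_ne hν, mul_zero, add_zero]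
    split_ifs
    · exact ⟨min_le_right _ _, le_max_right _ _⟩
    · exact ⟨min_le_left _ _, le_max_left _ _⟩

section Telescoping

variable (c : ℝ) (f : (Fin (d + 1) → ℤ) → V) (μ : Fin (d + 1))

/-- kernel: `η·(∂^η_μ f)(z) = f(z + e_μ) − f(z)` (`c = η⁻¹ ≠ 0`). [folklore] -/
private theorem inv_smul_pd (hc : c ≠ 0) (z : Fin (d + 1) → ℤ) :
    c⁻¹ • pd c μ f z = f (z + Pi.single μ 1) - f z := by
  rw [pd, smul_smul, inv_mul_cancel₀ hc, one_smul]

/-- kernel: `(t+1)e_μ = te_μ + e_μ`. [folklore] -/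
private theorem succ_smul_single (t : ℤ) :
    ((t + 1) • (Pi.single μ (1 : ℤ) : Fin (d + 1) → ℤ)) = t • (Pi.single μ (1 : ℤ) : Fin (d + 1) → ℤ) + Pi.single μ 1 := by
  rw [add_smul, one_smul]

/-- FORWARD telescoping along the `μ`-axis: `f(z + ne_μ) − f(z) = Σ_{t<n} η(∂^η_μf)(z + te_μ)`. [cite: Balaban1983Higgs3, (3.10) p.435] -/
theorem sub_eq_sum_pd_up (hc : c ≠ 0) (z : Fin (d + 1) → ℤ) (n : ℕ) :
    f (z + (n : ℤ) • (Pi.single μ (1 : ℤ) : Fin (d + 1) → ℤ)) - f z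
      = ∑ t ∈ Finset.range n, c⁻¹ • pd c μ f (z + (t : ℤ) • (Pi.single μ (1 : ℤ) : Fin (d + 1) → ℤ)) := by
  induction n with
  | zero => simp
  | succ n ih =>
    rw [Finset.sum_range_succ, ← ih, inv_smul_pd c f μ hc, add_assoc z, ← succ_smul_single]
    push_cast
    abel

/-- BACKWARD telescoping along the `μ`-axis: `f(z − ne_μ) − f(z) = −Σ_{t<n} η(∂^η_μf)(z − (t+1)e_μ)` (forward derivatives at the
lower end-points of the bonds). [cite: Balaban1983Higgs3, (3.10) p.435] -/
theorem sub_eq_sum_pd_down (hc : c ≠ 0) (z : Fin (d + 1) → ℤ) (n : ℕ) :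
    f (z + (-(n : ℤ)) • (Pi.single μ (1 : ℤ) : Fin (d + 1) → ℤ)) - f z
      = -∑ t ∈ Finset.range n, c⁻¹ • pd c μ f (z + (-((t : ℤ) + 1)) • (Pi.single μ (1 : ℤ) : Fin (d + 1) → ℤ)) := by
  induction n with
  | zero => simp
  | succ n ih =>
    rw [Finset.sum_range_succ, neg_add, ← ih, inv_smul_pd c f μ hc]
    have h : z + (-((n : ℤ) + 1)) • (Pi.single μ (1 : ℤ) : Fin (d + 1) → ℤ) + Pi.single μ 1
        = z + (-(n : ℤ)) • (Pi.single μ (1 : ℤ) : Fin (d + 1) → ℤ) := by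
      rw [add_assoc, show (-((n : ℤ) + 1)) • (Pi.single μ (1 : ℤ) : Fin (d + 1) → ℤ) + Pi.single μ 1
        = (-(n : ℤ)) • (Pi.single μ (1 : ℤ) : Fin (d + 1) → ℤ) from by rw [neg_add, add_smul, neg_one_smul, neg_add_cancel_right]]
    push_cast
    rw [h]
    abel

end Telescoping

/-! ## §3 The remainder along the contour and its bound: "a differentiation of the order 1 + α" (p. 436) -/

section Remainder

variable {c : ℝ}

/-- The remainder of the `μ`-segment of `Γ_{x,y}`: `f(mix(μ+1)) − f(mix μ) − (y_μ − x_μ)(∂^η_μf)(x)`.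
[cite: Balaban1983Higgs3, (3.10) p.435] -/
def segRem (c : ℝ) (f : (Fin (d + 1) → ℤ) → V) (x y : Fin (d + 1) → ℤ) (μ : Fin (d + 1)) : V :=
  f (mix x y ((μ : ℕ) + 1)) - f (mix x y μ) - (c⁻¹ * ((y μ - x μ : ℤ) : ℝ)) • pd c μ f x

/-- **The remainder is the sum of the segment remainders along the staircase** (`f(y) − f(x)` telescopes over the corners).
[cite: Balaban1983Higgs3, (3.10) p.435] -/
theorem rem_eq_sum_segRem (c : ℝ) (f : (Fin (d + 1) → ℤ) → V) (x y : Fin (d + 1) → ℤ) :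
    rem c f x y = ∑ μ : Fin (d + 1), segRem c f x y μ := by
  unfold rem lin segRem
  rw [Finset.sum_sub_distrib]
  congr 1
  have htel : ∑ μ : Fin (d + 1), (f (mix x y ((μ : ℕ) + 1)) - f (mix x y μ)) = f y - f x := by
    rw [Finset.sum_fin_eq_sum_range]
    have h2 : ∑ i ∈ Finset.range (d + 1), (if h : i < d + 1 then f (mix x y (i + 1)) - f (mix x y i) else 0)
        = ∑ i ∈ Finset.range (d + 1), (f (mix x y (i + 1)) - f (mix x y i)) :=
      Finset.sum_congr rfl fun i hi => by rw [dif_pos (Finset.mem_range.1 hi)]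
    rw [h2, Finset.sum_range_sub (fun i => f (mix x y i)), mix_top, mix_zero]
  rw [htel]

/-- **The segment remainder under an oscillation bound**: if `‖(∂^η_μf)(w) − (∂^η_μf)(x)‖ ≤ K` for every `w` between `x` and `y`,
then `‖segRem μ‖ ≤ η·|y_μ − x_μ|·K` (each of the `|y_μ − x_μ|` bonds of the segment contributes `η·((∂^ηf)(b) − (∂^ηf)(x))`).
[cite: Balaban1983Higgs3, (3.10) p.435] -/
theorem norm_segRem_le (hc : 0 < c) {K : ℝ} (f : (Fin (d + 1) → ℤ) → V) (x y : Fin (d + 1) → ℤ) (μ : Fin (d + 1))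
    (hosc : ∀ w, Between x y w → ‖pd c μ f w - pd c μ f x‖ ≤ K) :
    ‖segRem c f x y μ‖ ≤ c⁻¹ * ((y μ - x μ).natAbs : ℝ) * K := by
  have hc0 : c ≠ 0 := hc.ne'
  unfold segRem
  rw [mix_succ]
  set z := mix x y μ with hz
  rcases Int.natAbs_eq (y μ - x μ) with hpos | hneg
  · -- `y_μ ≥ x_μ`: forward segment
    set m : ℕ := (y μ - x μ).natAbs with hm
    rw [hpos, sub_eq_sum_pd_up c f μ hc0 z m]
    have hlin : (c⁻¹ * (((m : ℕ) : ℤ) : ℝ)) • pd c μ f x = ∑ _t ∈ Finset.range m, c⁻¹ • pd c μ f x := by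
      rw [Finset.sum_const, Finset.card_range, ← Nat.cast_smul_eq_nsmul ℝ, smul_smul]
      push_cast; ring_nf
    rw [hlin, ← Finset.sum_sub_distrib]
    calc ‖∑ t ∈ Finset.range m, (c⁻¹ • pd c μ f (z + (t : ℤ) • Pi.single μ 1) - c⁻¹ • pd c μ f x)‖
        ≤ ∑ t ∈ Finset.range m, ‖c⁻¹ • pd c μ f (z + (t : ℤ) • Pi.single μ 1) - c⁻¹ • pd c μ f x‖ := norm_sum_le _ _
      _ ≤ ∑ _t ∈ Finset.range m, c⁻¹ * K := by
          refine Finset.sum_le_sum fun t ht => ?_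
          rw [← smul_sub, norm_smul, Real.norm_of_nonneg (inv_nonneg.2 hc.le)]
          refine mul_le_mul_of_nonneg_left (hosc _ (between_segment x y μ ⟨?_, ?_⟩)) (inv_nonneg.2 hc.le)
          · have : (0 : ℤ) ≤ t := by positivity
            exact le_trans (min_le_left _ _) this
          · have ht' : (t : ℤ) < m := by exact_mod_cast Finset.mem_range.1 ht
            rw [hpos]; exact le_trans (by omega) (le_max_right _ _)
      _ = c⁻¹ * ((m : ℕ) : ℝ) * K := by
          rw [Finset.sum_const, Finset.card_range, nsmul_eq_mul]; ring
  · -- `y_μ < x_μ`: backward segment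
    set m : ℕ := (y μ - x μ).natAbs with hm
    rw [hneg, sub_eq_sum_pd_down c f μ hc0 z m]
    have hlin : (c⁻¹ * ((-((m : ℕ) : ℤ) : ℤ) : ℝ)) • pd c μ f x = -∑ _t ∈ Finset.range m, c⁻¹ • pd c μ f x := by
      rw [Finset.sum_const, Finset.card_range, ← Nat.cast_smul_eq_nsmul ℝ, smul_smul, ← neg_smul]
      push_cast; ring_nf
    rw [hlin, sub_neg_eq_add, neg_add_eq_sub, ← Finset.sum_sub_distrib]
    calc ‖∑ t ∈ Finset.range m, (c⁻¹ • pd c μ f x - c⁻¹ • pd c μ f (z + (-((t : ℤ) + 1)) • Pi.single μ 1))‖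
        ≤ ∑ t ∈ Finset.range m, ‖c⁻¹ • pd c μ f x - c⁻¹ • pd c μ f (z + (-((t : ℤ) + 1)) • Pi.single μ 1)‖ :=
          norm_sum_le _ _
      _ ≤ ∑ _t ∈ Finset.range m, c⁻¹ * K := by
          refine Finset.sum_le_sum fun t ht => ?_
          rw [← smul_sub, norm_smul, Real.norm_of_nonneg (inv_nonneg.2 hc.le), norm_sub_rev]
          refine mul_le_mul_of_nonneg_left (hosc _ (between_segment x y μ ⟨?_, ?_⟩)) (inv_nonneg.2 hc.le)
          · have ht' : (t : ℤ) < m := by exact_mod_cast Finset.mem_range.1 ht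
            rw [hneg]; exact le_trans (min_le_right _ _) (by omega)
          · exact le_trans (by omega) (le_max_left _ _)
      _ = c⁻¹ * ((m : ℕ) : ℝ) * K := by
          rw [Finset.sum_const, Finset.card_range, nsmul_eq_mul]; ring

/-- **THE REMAINDER UNDER AN OSCILLATION BOUND**: if `‖(∂^η_μf)(w) − (∂^η_μf)(x)‖ ≤ K` for every direction and every `w` between `x`
and `y`, then `‖rem(x,y)‖ ≤ η·|x − y|₁·K` (`Σ_{b⊂Γ_{x,y}} η = η|x−y|₁`). [cite: Balaban1983Higgs3, (3.10) p.435] -/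
theorem norm_rem_le_of_osc (hc : 0 < c) {K : ℝ} (f : (Fin (d + 1) → ℤ) → V) (x y : Fin (d + 1) → ℤ)
    (hosc : ∀ μ w, Between x y w → ‖pd c μ f w - pd c μ f x‖ ≤ K) :
    ‖rem c f x y‖ ≤ c⁻¹ * (dist₁ x y : ℝ) * K := by
  rw [rem_eq_sum_segRem]
  calc ‖∑ μ, segRem c f x y μ‖ ≤ ∑ μ, ‖segRem c f x y μ‖ := norm_sum_le _ _
    _ ≤ ∑ μ, c⁻¹ * ((y μ - x μ).natAbs : ℝ) * K := Finset.sum_le_sum fun μ _ => norm_segRem_le hc f x y μ (hosc μ)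
    _ = c⁻¹ * (dist₁ x y : ℝ) * K := by
        rw [dist₁_comm, dist₁, Nat.cast_sum, Finset.mul_sum, Finset.sum_mul]

/-- **Hölder continuity of the derivative** (the hypothesis under which the remainder is «a differentiation of the order 1 + α»):
`‖(∂^η_μf)(z) − (∂^η_μf)(z′)‖ ≤ H·|z − z′|^α`, `|z − z′| = η|z − z′|₁`. [cite: Balaban1983Higgs3, (3.13) p.436] -/
def HolderDeriv (c α H : ℝ) (f : (Fin (d + 1) → ℤ) → V) : Prop :=
  ∀ (μ : Fin (d + 1)) (z z' : Fin (d + 1) → ℤ), ‖pd c μ f z - pd c μ f z'‖ ≤ H * (c⁻¹ * (dist₁ z z' : ℝ)) ^ α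

/-- **THE HÖLDER BOUND ON THE REMAINDER** — p. 436: *"The operator acting on the leg φ′ is a differentiation of the order 1 + α"*, the
last factor of (3.13): under `HolderDeriv c α H f` (`α ≥ 0`, `H ≥ 0`), `‖rem(x,y)‖ ≤ H·|x − y|·|x − y|^α` (`|x − y| = η|x − y|₁`).
[cite: Balaban1983Higgs3, (3.13) p.436] -/
theorem norm_rem_le (hc : 0 < c) {α H : ℝ} (hα : 0 ≤ α) (hH : 0 ≤ H) {f : (Fin (d + 1) → ℤ) → V}
    (hf : HolderDeriv c α H f) (x y : Fin (d + 1) → ℤ) :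
    ‖rem c f x y‖ ≤ H * (c⁻¹ * (dist₁ x y : ℝ)) * (c⁻¹ * (dist₁ x y : ℝ)) ^ α := by
  have h := norm_rem_le_of_osc hc f x y (K := H * (c⁻¹ * (dist₁ x y : ℝ)) ^ α) fun μ w hw => by
    refine (hf μ w x).trans (mul_le_mul_of_nonneg_left ?_ hH)
    exact Real.rpow_le_rpow (by positivity)
      (mul_le_mul_of_nonneg_left (by exact_mod_cast dist₁_le_of_between hw) (inv_nonneg.2 hc.le)) hα
  calc ‖rem c f x y‖ ≤ c⁻¹ * (dist₁ x y : ℝ) * (H * (c⁻¹ * (dist₁ x y : ℝ)) ^ α) := h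
    _ = H * (c⁻¹ * (dist₁ x y : ℝ)) * (c⁻¹ * (dist₁ x y : ℝ)) ^ α := by ring

/-- **THE LOCAL VERSION** (towards (3.14) p. 436: *"If φ′ is a leg of a propagator with an index j″, whose second leg is localized
in Δ(v″), then the last supremum in (3.13) can be estimated by O(1)(L^{j″}η)^{−d+1−α} sup exp[−δ₀(L^{j″}η)^{−1}dist(Γ_{x,x′},Δ(v″))]"*):
under the (2.11)-shaped two-point bound `‖(∂^η_μf)(z) − (∂^η_μf)(z′)‖ ≤ C₃|z − z′|^α e^{−δ(s″)^{−1}η·min(|z−x″|₁,|z′−x″|₁)}` the remainder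
satisfies `‖rem(x,y)‖ ≤ C₃·|x−y|·|x−y|^α·e^{+½δ|x−y|/s″}·e^{−½δη|x−x″|₁/s″}` — every site of `Γ_{x,y}` is within `|x − y|₁` of `x`, hence
at least `|x − x″|₁ − |x − y|₁` from `x″`; half of the `x″`-exponential is kept (the shape of p20's `B3Ineq314Local.norm_remFwd_le_of_leg`,
with the constant `C₃` in place of `8C₃e^{δ/2}`). [cite: Balaban1983Higgs3, (3.14) p.436] -/
theorem norm_rem_le_of_leg (hc : 0 < c) {α C₃ δ s'' : ℝ} (hα : 0 ≤ α) (hC₃ : 0 ≤ C₃) (hδ : 0 < δ) (hs'' : 0 < s'')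
    {f : (Fin (d + 1) → ℤ) → V} (x'' : Fin (d + 1) → ℤ)
    (hleg : ∀ (μ : Fin (d + 1)) (z z' : Fin (d + 1) → ℤ), ‖pd c μ f z - pd c μ f z'‖ ≤
      C₃ * (c⁻¹ * (dist₁ z z' : ℝ)) ^ α * Real.exp (-(δ * s''⁻¹ * (c⁻¹ * ((min (dist₁ z x'') (dist₁ z' x'') : ℕ) : ℝ)))))
    (x y : Fin (d + 1) → ℤ) :
    ‖rem c f x y‖ ≤ C₃ * ((c⁻¹ * (dist₁ x y : ℝ)) * (c⁻¹ * (dist₁ x y : ℝ)) ^ α) *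
      Real.exp (δ / 2 * s''⁻¹ * (c⁻¹ * (dist₁ x y : ℝ))) * Real.exp (-(δ / 2 * s''⁻¹ * (c⁻¹ * (dist₁ x x'' : ℝ)))) := by
  set n : ℕ := dist₁ x y with hn
  set K : ℝ := C₃ * (c⁻¹ * (n : ℝ)) ^ α *
    (Real.exp (δ / 2 * s''⁻¹ * (c⁻¹ * (n : ℝ))) * Real.exp (-(δ / 2 * s''⁻¹ * (c⁻¹ * (dist₁ x x'' : ℝ))))) with hK
  have hosc : ∀ μ w, Between x y w → ‖pd c μ f w - pd c μ f x‖ ≤ K := by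
    intro μ w hw
    refine (hleg μ w x).trans ?_
    have hwx : dist₁ w x ≤ n := dist₁_le_of_between hw
    -- `min(|w − x″|, |x − x″|) + n ≥ |x − x″|`
    have hmin : dist₁ x x'' ≤ min (dist₁ w x'') (dist₁ x x'') + n := by
      have h1 : dist₁ x x'' ≤ dist₁ x w + dist₁ w x'' := dist₁_triangle x w x''
      rw [dist₁_comm x w] at h1
      rcases le_total (dist₁ w x'') (dist₁ x x'') with h | h
      · rw [min_eq_left h]; omega
      · rw [min_eq_right h]; omega
    have hA : C₃ * (c⁻¹ * (dist₁ w x : ℝ)) ^ α ≤ C₃ * (c⁻¹ * (n : ℝ)) ^ α :=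
      mul_le_mul_of_nonneg_left (Real.rpow_le_rpow (by positivity)
        (mul_le_mul_of_nonneg_left (by exact_mod_cast hwx) (inv_nonneg.2 hc.le)) hα) hC₃
    have hB : Real.exp (-(δ * s''⁻¹ * (c⁻¹ * ((min (dist₁ w x'') (dist₁ x x'') : ℕ) : ℝ))))
        ≤ Real.exp (δ / 2 * s''⁻¹ * (c⁻¹ * (n : ℝ))) * Real.exp (-(δ / 2 * s''⁻¹ * (c⁻¹ * (dist₁ x x'' : ℝ)))) := by
      rw [← Real.exp_add, Real.exp_le_exp]
      have hq : 0 ≤ δ * s''⁻¹ * c⁻¹ := by positivity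
      have hm0 : (0 : ℝ) ≤ ((min (dist₁ w x'') (dist₁ x x'') : ℕ) : ℝ) := Nat.cast_nonneg _
      have hmin' : (dist₁ x x'' : ℝ) ≤ ((min (dist₁ w x'') (dist₁ x x'') : ℕ) : ℝ) + n := by exact_mod_cast hmin
      -- `e^{−δ q m} ≤ e^{−(δ/2) q m} ≤ e^{(δ/2) q n}·e^{−(δ/2) q D}`
      nlinarith [mul_le_mul_of_nonneg_left hmin' hq, mul_nonneg hq hm0]
    calc C₃ * (c⁻¹ * (dist₁ w x : ℝ)) ^ α * Real.exp (-(δ * s''⁻¹ * (c⁻¹ * ((min (dist₁ w x'') (dist₁ x x'') : ℕ) : ℝ))))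
        ≤ C₃ * (c⁻¹ * (n : ℝ)) ^ α *
          (Real.exp (δ / 2 * s''⁻¹ * (c⁻¹ * (n : ℝ))) * Real.exp (-(δ / 2 * s''⁻¹ * (c⁻¹ * (dist₁ x x'' : ℝ))))) :=
          mul_le_mul hA hB (by positivity) (by positivity)
      _ = K := by rw [hK]
  calc ‖rem c f x y‖ ≤ c⁻¹ * (n : ℝ) * K := norm_rem_le_of_osc hc f x y hosc
    _ = _ := by rw [hK]; ring

end Remainder

end

end Literature.MathematicalPhysics.QuantumFieldTheory.Balaban1983to89.B3Taylor310Lattice
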